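import Summits.NavierStokesRegularity.NavierStokesRegularity.Theorems.StrainDoorsNearRecordSecondOrderRate
import Summits.NavierStokesRegularity.NavierStokesRegularity.Theorems.StrainDoorsNearRecordClockRate
import HarnessLib

/-!
# StrainDoorsNearRecordStretchingBalance — PART M §M12: THE QUANTITATIVE RECORD LAW

nsreg-p1 g36, ROUND-63 (helper lane of `stmt-NavierStokesRegularity-0056`, rung N0; 0 ledger writes by the
planner — text for the S-lane to land `--supports stmt-NavierStokesRegularity-0056 --as helper`; tree file 5 of 5
of ROUND-63 — lands AFTER `StrainDoorsNearRecordGradientRate`, `StrainDoorsNearRecordSecondOrderRate`,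
`StrainDoorsNearRecordClockRate`; body farm-certified inside `r63/StrainDoorsR63All.lean`, rc 0 · 0 warn · 0 sorry,
std axioms).

ROUND 53's RECORD LAW says that at a new space-time maximum of `(T − t)|ω|` the stretching rate must beat the
self-similar rate plus the viscous twist: `(T − t)α ≥ 1 + (T − t)(|∇ξ|²_F + |∇log|ω||²)`.  Adding the three
compactness-free near-record laws of ROUND 63 — the gradient law `O(√δ)` (§M7), the Laplacian law `O(δ^{1/3})`
(§M9) and the clock law `O(√δ)` (§M11) — and the Type-I decay `√(0 − t)|u(t,x)| ≤ C₀` for the transport term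
`⟪ω, ∇ω·u⟫ = |ω|(∇|ω|·u)`, gives the record law WITH AN ERROR TERM at every `δ`-near-record point of a classical
Type-I ancient solution, uniformly in the class:

* `le_rpow_third_of_pow_three_le` — `y³ ≤ c`, `c ≥ 0` ⟹ `y ≤ c^{1/3}`;
* ★ `typeI_nearRecord_transport_rate` — the transport term is `O(√δ)`:
  `|(0 − t)³⟪ω, ∇ω·u⟫(t,x)| ≤ C₀√(A·W·δ)` (instant domination; `⟪ω, ∇ω·u⟫ = |ω|(∇|ω|·u)`, §M7, Type-I decay);
* ★★★ `typeI_nearRecord_stretching_viscous_balance` — STRETCHING EXCESS = VISCOUS LOSS up to `√δ`: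
  `|(0 − t)³⟪ω, ∇u·ω⟫ + (0 − t)³⟪ω, Δω⟫ − ((0 − t)|ω|)²|(t,x) ≤ √(A·W·δ)` (two-sided clock law + transport law);
* ★★★ `typeI_nearRecord_reduced_stretching_rate` — ROUND 62's reduced-stretching floor WITH A RATE:
  `((0 − t)|ω|)²·(1 − (0 − t)(α − |∇ξ|²_F))(t,x) ≤ √(A·W·δ) + (A·W·δ)^{1/3}` at every near-record with `ω ≠ 0`;
* ★★★ `typeI_nearRecord_stretching_balance` — there is `A = A(C₀)` with
  `(0 − t)³|∇ω(t,x)|²_F + ((0 − t)|ω(t,x)|)² ≤ (0 − t)³⟪ω, ∇u·ω⟫(t,x) + √(A·W·δ) + (A·W·δ)^{1/3}`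
  whenever `(0 − s)|ω(s,y)| ≤ W` for all `s < 0`, `y` and `(0 − t)|ω(t,x)| ≥ W − δ ≥ W − W`, `δ ≥ 0`.
  At an exact record (`δ = 0`) this is the record law; since `|∇ω|²_F = |ω|²|∇ξ|²_F + |∇|ω||²` wherever `ω ≠ 0`
  (PART F), dividing by `((0 − t)|ω|)²` displays the twist floor with the error `O(δ^{1/3})/((0 − t)|ω|)²`.

WHAT THIS IS NOT: a necessary condition at near-record points; nothing here excludes a blow-up; `0056` / `10661` /
NS regularity are NOT proved; the peak doors of PART K stay OPEN.  No new definitions; no sorry.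
[cite: KochNadirashviliSereginSverak2009, §2 p. 5, (4.11); ChaeWolf2017RemovingDSS, §3 Step 2;
ConstantinFefferman1993, §1]
-/

noncomputable section

open MeasureTheory Set Function Filter Metric Real InnerProductSpace
open _root_.Topology
open scoped ENNReal NNReal RealInnerProductSpace ContDiff Laplacian
open Literature.Analysis Literature.Analysis.FluidPDE
open Literature.Analysis.FluidPDE.VorticityDirectionDynamics

set_option linter.dupNamespace false
set_option maxSynthPendingDepth 3

namespace Summit.NavierStokesRegularity.NavierStokesRegularity.Theorems.StrainDoors

open Summit.NavierStokesRegularity.NavierStokesRegularity.Theorems.ArgmaxDoors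


/-- A real with `y³ ≤ c`, `c ≥ 0`, satisfies `y ≤ c^{1/3}`. [folklore] -/
theorem le_rpow_third_of_pow_three_le {y c : ℝ} (hc : 0 ≤ c) (h : y ^ 3 ≤ c) : y ≤ c ^ (1 / 3 : ℝ) := by
  by_cases hy : 0 ≤ y
  · calc y = (y ^ 3) ^ (1 / 3 : ℝ) := by
          rw [show (1 / 3 : ℝ) = ((3 : ℕ) : ℝ)⁻¹ by norm_num, Real.pow_rpow_inv_natCast hy (by norm_num)]
      _ ≤ c ^ (1 / 3 : ℝ) := Real.rpow_le_rpow (pow_nonneg hy 3) h (by norm_num)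
  · exact (lt_of_not_ge hy).le.trans (Real.rpow_nonneg hc _)

/-- ★ **The transport term at a near-record is `O(√δ)`.**  For every `C₀ ≥ 0` there is `A = A(C₀) ≥ 0` with
`|(0 − t)³⟪ω, ∇ω·u⟫(t,x)| ≤ C₀·√(A·W·δ)` at every `δ`-near-record point `(t,x)` of a classical Type-I solution whose
scale-invariant vorticity is dominated by `W` at the instant `t`: indeed `⟪ω, ∇ω·u⟫ = |ω|·(∇|ω|·u)`, the gradient
deficit law (§M7) bounds `((0 − t)|ω|)((0 − t)^{3/2}|∇|ω||) ≤ √(A·W·δ)` and Type-I decay gives `√(0 − t)|u(t,x)| ≤ C₀`.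
[new-as-typed] -/
theorem typeI_nearRecord_transport_rate {C₀ : ℝ} (hC₀ : 0 ≤ C₀) :
    ∃ A : ℝ, 0 ≤ A ∧
      ∀ (u : ℝ → (EuclideanSpace ℝ (Fin 3)) → (EuclideanSpace ℝ (Fin 3))) (p : ℝ → (EuclideanSpace ℝ (Fin 3)) → ℝ)
        (W t δ : ℝ) (x : EuclideanSpace ℝ (Fin 3)),
        IsClassicalNSSolutionOn (Iio 0) 1 0 u p → HasTypeIDecay C₀ u → t < 0 →
        (∀ y, (0 - t) * ‖curl (u t) y‖ ≤ W) → 0 ≤ δ → W - δ ≤ (0 - t) * ‖curl (u t) x‖ →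
        |(0 - t) ^ 3 * ⟪curl (u t) x, fderiv ℝ (curl (u t)) x (u t x)⟫| ≤ C₀ * √(A * W * δ) := by
  obtain ⟨A₀, hA₀, hgradlaw⟩ := typeI_vorticityModulus_gradient_deficit hC₀
  refine ⟨A₀, hA₀, fun u p W t δ x hsol hI ht hdom hδ hnear => ?_⟩
  have ht0 : 0 < 0 - t := by linarith
  have h1 := hgradlaw u p W t δ x hsol hI ht hdom hδ hnear
  have hu : √(0 - t) * ‖u t x‖ ≤ C₀ := by
    have h := ChaeWolf.typeI_norm_le_div_sqrt hC₀ hI ht x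
    rw [show -t = 0 - t by ring] at h
    have hs : 0 < √(0 - t) := Real.sqrt_pos.mpr ht0
    rw [mul_comm]
    exact (le_div_iff₀ hs).1 h
  by_cases hω0 : curl (u t) x = 0
  · rw [hω0, inner_zero_left, mul_zero, abs_zero]; positivity
  · have hdiff : DifferentiableAt ℝ (curl (u t)) x :=
      ((contDiff_curl (n := ⊤) ((hsol.contDiff_velocity (show t ∈ Iio (0:ℝ) from ht)).of_le
        (by exact_mod_cast (le_top : (⊤ + 1 : ℕ∞) ≤ ⊤)))).differentiable (by norm_cast)) x
    have hgrad : fderiv ℝ (fun y => ‖curl (u t) y‖) x =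
        (innerSL ℝ (vorticityDirection (curl (u t)) x)).comp (fderiv ℝ (curl (u t)) x) :=
      (hasFDerivAt_norm hdiff.hasFDerivAt hω0).fderiv
    have hid : ⟪curl (u t) x, fderiv ℝ (curl (u t)) x (u t x)⟫ =
        ‖curl (u t) x‖ * fderiv ℝ (fun y => ‖curl (u t) y‖) x (u t x) := by
      rw [hgrad, ContinuousLinearMap.coe_comp, Function.comp_apply, innerSL_apply_apply]
      have e : curl (u t) x = ‖curl (u t) x‖ • vorticityDirection (curl (u t)) x := by
        rw [vorticityDirection_apply, smul_inv_smul₀ (norm_ne_zero_iff.mpr hω0)]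
      conv_lhs => rw [e]
      rw [real_inner_smul_left]
    rw [hid, abs_mul, abs_of_pos (pow_pos ht0 3), abs_mul, abs_of_nonneg (norm_nonneg _)]
    have hb : |fderiv ℝ (fun y => ‖curl (u t) y‖) x (u t x)| ≤
        ‖fderiv ℝ (fun y => ‖curl (u t) y‖) x‖ * ‖u t x‖ := by
      rw [← Real.norm_eq_abs]; exact ContinuousLinearMap.le_opNorm _ _
    have e3 : (0 - t) ^ 3 = ((0 - t) * ((0 - t) * √(0 - t))) * √(0 - t) := by
      rw [mul_assoc, mul_assoc, Real.mul_self_sqrt ht0.le]; ring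
    have hnn1 : 0 ≤ (0 - t) * ‖curl (u t) x‖ := by positivity
    have hnn2 : 0 ≤ (0 - t) * √(0 - t) * ‖fderiv ℝ (fun y => ‖curl (u t) y‖) x‖ := by positivity
    calc (0 - t) ^ 3 * (‖curl (u t) x‖ * |fderiv ℝ (fun y => ‖curl (u t) y‖) x (u t x)|)
        ≤ (0 - t) ^ 3 * (‖curl (u t) x‖ * (‖fderiv ℝ (fun y => ‖curl (u t) y‖) x‖ * ‖u t x‖)) := by
          gcongr
      _ = (((0 - t) * ‖curl (u t) x‖) * ((0 - t) * √(0 - t) * ‖fderiv ℝ (fun y => ‖curl (u t) y‖) x‖)) *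
            (√(0 - t) * ‖u t x‖) := by rw [e3]; ring
      _ ≤ √(A₀ * W * δ) * C₀ := mul_le_mul h1 hu (by positivity) (Real.sqrt_nonneg _)
      _ = C₀ * √(A₀ * W * δ) := mul_comm _ _

/-- ★★★ **STRETCHING EXCESS = VISCOUS LOSS AT NEAR-RECORDS, UP TO `√δ`.**  For every `C₀ ≥ 0` there is
`A = A(C₀) ≥ 0` such that at every `δ`-near-record point `(t,x)` of a classical Type-I ancient solution whose
scale-invariant vorticity is dominated by `W` (all `s < 0`, all `y`):
`|(0 − t)³⟪ω, ∇u·ω⟫ + (0 − t)³⟪ω, Δω⟫ − ((0 − t)|ω|)²|(t,x) ≤ √(A·W·δ)`,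
i.e. `((0 − t)α − 1)·((0 − t)|ω|)² = −(0 − t)³⟪ω, Δω⟫ + O(√δ)`: the amount by which the stretching rate exceeds the
self-similar rate is EXACTLY the (sign-indefinite a priori, here a-posteriori `≥ (0 − t)³|∇ω|²_F − O(δ^{1/3})`)
viscous term, up to the square root of the record deficit.  The clock law (two-sided) plus the transport law.
[new-as-typed] -/
theorem typeI_nearRecord_stretching_viscous_balance {C₀ : ℝ} (hC₀ : 0 ≤ C₀) :
    ∃ A : ℝ, 0 ≤ A ∧
      ∀ (u : ℝ → (EuclideanSpace ℝ (Fin 3)) → (EuclideanSpace ℝ (Fin 3))) (p : ℝ → (EuclideanSpace ℝ (Fin 3)) → ℝ)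
        (W t δ : ℝ) (x : EuclideanSpace ℝ (Fin 3)),
        IsClassicalNSSolutionOn (Iio 0) 1 0 u p → HasTypeIDecay C₀ u → t < 0 →
        (∀ s : ℝ, s < 0 → ∀ y, (0 - s) * ‖curl (u s) y‖ ≤ W) → 0 ≤ δ → W - δ ≤ (0 - t) * ‖curl (u t) x‖ →
        |(0 - t) ^ 3 * ⟪curl (u t) x, fderiv ℝ (u t) x (curl (u t) x)⟫ +
            (0 - t) ^ 3 * ⟪curl (u t) x, (Δ (curl (u t))) x⟫ - ((0 - t) * ‖curl (u t) x‖) ^ 2| ≤ √(A * W * δ) := by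
  obtain ⟨A₀, hA₀, htrans⟩ := typeI_nearRecord_transport_rate hC₀
  obtain ⟨A₁, hA₁, hclock⟩ := typeI_nearRecord_clock_rate hC₀
  refine ⟨(√A₁ + C₀ * √A₀) ^ 2, by positivity, fun u p W t δ x hsol hI ht hdom hδ hnear => ?_⟩
  have ht0 : 0 < 0 - t := by linarith
  have hW0 : 0 ≤ W := by
    have h := hdom t ht x
    have : 0 ≤ (0 - t) * ‖curl (u t) x‖ := by positivity
    linarith
  have hT := abs_le.1 (htrans u p W t δ x hsol hI ht (hdom t ht) hδ hnear)
  have hQ := abs_le.1 (Real.abs_le_sqrt (hclock u p W t δ x hsol hI ht (fun s hs => hdom s hs x) hδ hnear))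
  have hsum : √(A₁ * W * δ) + C₀ * √(A₀ * W * δ) = √((√A₁ + C₀ * √A₀) ^ 2 * W * δ) := by
    have hnn : 0 ≤ √A₁ + C₀ * √A₀ := by positivity
    have e1 : √(A₁ * W * δ) = √A₁ * √(W * δ) := by rw [mul_assoc, Real.sqrt_mul hA₁]
    have e0 : √(A₀ * W * δ) = √A₀ * √(W * δ) := by rw [mul_assoc, Real.sqrt_mul hA₀]
    have e2 : √((√A₁ + C₀ * √A₀) ^ 2 * W * δ) = (√A₁ + C₀ * √A₀) * √(W * δ) := by
      rw [mul_assoc, Real.sqrt_mul (sq_nonneg (√A₁ + C₀ * √A₀)), Real.sqrt_sq hnn]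
    rw [e1, e0, e2]
    ring
  rw [← hsum, abs_le]
  rw [inner_add_right, inner_sub_right] at hQ
  constructor <;> linarith [hT.1, hT.2, hQ.1, hQ.2]

/-- ★★★ **THE QUANTITATIVE RECORD LAW (stretching balance at near-records, compactness-free).**  For every
`C₀ ≥ 0` there is `A = A(C₀) ≥ 0` such that for every classical Type-I solution on `(−∞,0) × ℝ³` whose
scale-invariant vorticity is dominated by `W` (`(0 − s)|ω(s,y)| ≤ W` for all `s < 0`, `y`) and every point
`(t,x)` with `(0 − t)|ω(t,x)| ≥ W − δ`, `δ ≥ 0`: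
`(0 − t)³|∇ω(t,x)|²_F + ((0 − t)|ω(t,x)|)² ≤ (0 − t)³⟪ω, ∇u·ω⟫(t,x) + √(A·W·δ) + (A·W·δ)^{1/3}`.
Dividing by `((0 − t)|ω|)²` this is the RECORD LAW of ROUND 53 WITH AN ERROR TERM at every near-record point:
`(0 − t)·α ≥ 1 + (0 − t)(|∇ξ|²_F + |∇log|ω||²) − O(δ^{1/3})/((0 − t)|ω|)²` — the stretching rate must beat the
self-similar rate `1/(0 − t)` PLUS the viscous twist, up to an explicit power of the record deficit `δ`.
Proof: the clock law with a rate (`typeI_nearRecord_clock_rate`), the Laplacian deficit law of §M9 and the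
gradient deficit law of §M7 (the transport term `⟪ω, ∇ω·u⟫ = |ω|·∇|ω|·u` is `O(√δ)` by Type-I decay of `u`),
added up. [new-as-typed] -/
theorem typeI_nearRecord_stretching_balance {C₀ : ℝ} (hC₀ : 0 ≤ C₀) :
    ∃ A : ℝ, 0 ≤ A ∧
      ∀ (u : ℝ → (EuclideanSpace ℝ (Fin 3)) → (EuclideanSpace ℝ (Fin 3))) (p : ℝ → (EuclideanSpace ℝ (Fin 3)) → ℝ)
        (W t δ : ℝ) (x : EuclideanSpace ℝ (Fin 3)),
        IsClassicalNSSolutionOn (Iio 0) 1 0 u p → HasTypeIDecay C₀ u → t < 0 →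
        (∀ s : ℝ, s < 0 → ∀ y, (0 - s) * ‖curl (u s) y‖ ≤ W) → 0 ≤ δ → W - δ ≤ (0 - t) * ‖curl (u t) x‖ →
        (0 - t) ^ 3 * frobeniusNormSq (fderiv ℝ (curl (u t)) x) + ((0 - t) * ‖curl (u t) x‖) ^ 2 ≤
          (0 - t) ^ 3 * ⟪curl (u t) x, fderiv ℝ (u t) x (curl (u t) x)⟫ +
            (√(A * W * δ) + (A * W * δ) ^ (1 / 3 : ℝ)) := by
  obtain ⟨A₀, hA₀, htrans⟩ := typeI_nearRecord_transport_rate hC₀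
  obtain ⟨A₁, hA₁, hclock⟩ := typeI_nearRecord_clock_rate hC₀
  obtain ⟨A₂, hA₂, hlap⟩ := typeI_vorticity_laplacian_deficit hC₀
  refine ⟨(√A₁ + C₀ * √A₀) ^ 2 + A₂, by positivity, fun u p W t δ x hsol hI ht hdom hδ hnear => ?_⟩
  have ht0 : 0 < 0 - t := by linarith
  have hW0 : 0 ≤ W := by
    have h := hdom t ht x
    have : 0 ≤ (0 - t) * ‖curl (u t) x‖ := by positivity
    linarith
  have hWδ : 0 ≤ W * δ := mul_nonneg hW0 hδ
  -- the three laws at `(t,x)`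
  have hT := (abs_le.1 (htrans u p W t δ x hsol hI ht (hdom t ht) hδ hnear)).1
  have h2 := hclock u p W t δ x hsol hI ht (fun s hs => hdom s hs x) hδ hnear
  have h3 := hlap u p W t δ x hsol hI ht (hdom t ht) hδ hnear
  have hQ := (abs_le.1 (Real.abs_le_sqrt h2)).1
  have hL := le_rpow_third_of_pow_three_le (by positivity : 0 ≤ A₂ * W * δ) h3
  -- the error terms against `A`
  have hsum : √(A₁ * W * δ) + C₀ * √(A₀ * W * δ) ≤ √(((√A₁ + C₀ * √A₀) ^ 2 + A₂) * W * δ) := by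
    have e1 : √(A₁ * W * δ) = √A₁ * √(W * δ) := by rw [mul_assoc, Real.sqrt_mul hA₁]
    have e0 : √(A₀ * W * δ) = √A₀ * √(W * δ) := by rw [mul_assoc, Real.sqrt_mul hA₀]
    have hA0 : 0 ≤ (√A₁ + C₀ * √A₀) ^ 2 + A₂ := by positivity
    have e2 : √(((√A₁ + C₀ * √A₀) ^ 2 + A₂) * W * δ) = √((√A₁ + C₀ * √A₀) ^ 2 + A₂) * √(W * δ) := by
      rw [mul_assoc, Real.sqrt_mul hA0]
    rw [e1, e0, e2, show √A₁ * √(W * δ) + C₀ * (√A₀ * √(W * δ)) = (√A₁ + C₀ * √A₀) * √(W * δ) by ring]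
    refine mul_le_mul_of_nonneg_right ?_ (Real.sqrt_nonneg _)
    have hsq : (√A₁ + C₀ * √A₀) ^ 2 ≤ (√A₁ + C₀ * √A₀) ^ 2 + A₂ := by linarith
    exact (le_abs_self _).trans (Real.abs_le_sqrt hsq)
  have hcube : (A₂ * W * δ) ^ (1 / 3 : ℝ) ≤ (((√A₁ + C₀ * √A₀) ^ 2 + A₂) * W * δ) ^ (1 / 3 : ℝ) := by
    refine Real.rpow_le_rpow (by positivity) ?_ (by norm_num)
    have : A₂ * (W * δ) ≤ ((√A₁ + C₀ * √A₀) ^ 2 + A₂) * (W * δ) :=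
      mul_le_mul_of_nonneg_right (by nlinarith [sq_nonneg (√A₁ + C₀ * √A₀)]) hWδ
    nlinarith
  -- add up
  rw [inner_add_right, inner_sub_right] at hQ
  linarith [hQ, hL, hT, hsum, hcube]

/-- ★★★ **THE REDUCED-STRETCHING LAW WITH A RATE (ROUND 62's T3 made quantitative and compactness-free).**
For every `C₀ ≥ 0` there is `A = A(C₀) ≥ 0` such that at every `δ`-near-record point `(t,x)` with `ω(t,x) ≠ 0`
of a classical Type-I ancient solution whose scale-invariant vorticity is dominated by `W` (all `s < 0`, all `y`),
with `ξ = ω/|ω|`, `α = ⟪ξ, ∇u ξ⟫` and the twist `|∇ξ|²_F`: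
`((0 − t)|ω(t,x)|)²·(1 − (0 − t)(α − |∇ξ|²_F)(t,x)) ≤ √(A·W·δ) + (A·W·δ)^{1/3}`.
ROUND 62 proved `1 − ε ≤ (0 − t)(α − |∇ξ|²_F)` for `δ ≤ δ(C₀,w₀,ε)` by extraction of a tangent peak; here the
`ε` is an explicit power of `δ` divided by `((0 − t)|ω|)² ≥ (W − δ)²`.  The quantitative record law
(`typeI_nearRecord_stretching_balance`) plus the tree's `|ω|²|∇ξ|²_F ≤ |∇ω|²_F`
(`ArgmaxDoors.sq_norm_mul_frobeniusNormSq_vorticityDirection_le`) and `⟪ω, ∇u ω⟫ = |ω|²α`. [new-as-typed] -/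
theorem typeI_nearRecord_reduced_stretching_rate {C₀ : ℝ} (hC₀ : 0 ≤ C₀) :
    ∃ A : ℝ, 0 ≤ A ∧
      ∀ (u : ℝ → (EuclideanSpace ℝ (Fin 3)) → (EuclideanSpace ℝ (Fin 3))) (p : ℝ → (EuclideanSpace ℝ (Fin 3)) → ℝ)
        (W t δ : ℝ) (x : EuclideanSpace ℝ (Fin 3)),
        IsClassicalNSSolutionOn (Iio 0) 1 0 u p → HasTypeIDecay C₀ u → t < 0 →
        (∀ s : ℝ, s < 0 → ∀ y, (0 - s) * ‖curl (u s) y‖ ≤ W) → 0 ≤ δ → W - δ ≤ (0 - t) * ‖curl (u t) x‖ →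
        curl (u t) x ≠ 0 →
        ((0 - t) * ‖curl (u t) x‖) ^ 2 *
            (1 - (0 - t) * (⟪vorticityDirection (curl (u t)) x,
              fderiv ℝ (u t) x (vorticityDirection (curl (u t)) x)⟫ -
              frobeniusNormSq (fderiv ℝ (vorticityDirection (curl (u t))) x))) ≤
          √(A * W * δ) + (A * W * δ) ^ (1 / 3 : ℝ) := by
  obtain ⟨A, hA, hbal⟩ := typeI_nearRecord_stretching_balance hC₀
  refine ⟨A, hA, fun u p W t δ x hsol hI ht hdom hδ hnear hne => ?_⟩
  have ht0 : 0 < 0 - t := by linarith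
  have h := hbal u p W t δ x hsol hI ht hdom hδ hnear
  have hdiff : DifferentiableAt ℝ (curl (u t)) x :=
    ((contDiff_curl (n := ⊤) ((hsol.contDiff_velocity (show t ∈ Iio (0:ℝ) from ht)).of_le
      (by exact_mod_cast (le_top : (⊤ + 1 : ℕ∞) ≤ ⊤)))).differentiable (by norm_cast)) x
  -- the twist is dominated by the vorticity gradient: `|ω|²|∇ξ|²_F ≤ |∇ω|²_F` (tree: ArgmaxDoorsPenalisedGrowth)
  have htw := ArgmaxDoors.sq_norm_mul_frobeniusNormSq_vorticityDirection_le hdiff hne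
  have hstr : ⟪curl (u t) x, fderiv ℝ (u t) x (curl (u t) x)⟫ =
      ‖curl (u t) x‖ ^ 2 * ⟪vorticityDirection (curl (u t)) x,
        fderiv ℝ (u t) x (vorticityDirection (curl (u t)) x)⟫ := by
    conv_lhs => rw [← norm_smul_vorticityDirection (curl (u t)) x]
    rw [map_smul, real_inner_smul_left, real_inner_smul_right]
    ring
  rw [hstr] at h
  have h3 : 0 ≤ (0 - t) ^ 3 := by positivity
  have hmono := mul_le_mul_of_nonneg_left htw h3
  nlinarith [hmono, h]

end Summit.NavierStokesRegularity.NavierStokesRegularity.Theorems.StrainDoors
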